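import Mathlib
import Summits.Ventures.PercRepro2.Defs
import Summits.Ventures.PercRepro2.Graph
import Summits.Ventures.PercRepro2.Harris
import Summits.Ventures.PercRepro2.Induced
import Summits.Ventures.PercRepro2.VdBKahn
import Summits.Ventures.PercRepro2.CaseOnePendantNec
import Summits.Ventures.PercRepro2.AvoidSameSideDel
import Summits.Ventures.PercRepro2.RowC1Cross

/-!
# The two halves of the single-edge cross term of row 2′C1; the root-edge open half is a theorem
(blind cell PercRepro2, p2 g33; proofs/P2-G33-CROSS.md §3–§4)

The cross term of `RowC1Cross.lean` splits as `c1Cross p e = c1CrossClosedHalf + c1CrossOpenHalf`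
(`c1Cross_eq_halves`) with

  `c1CrossOpenHalf   = P¹(Q) P⁰(Q oU bU) − P¹(Q bH) P⁰(Q oU)`   (the `e`-open copy carries `Q bH`),
  `c1CrossClosedHalf = P⁰(Q) P¹(Q oU bU) − P⁰(Q bH) P¹(Q oU)`.

For a ROOT EDGE `e = {a₁, v}` the open half is a THEOREM modulo the row for `p[e↦0]`
(`crossOpenHalf_nonneg_of_row`): `P¹(Q bH) · P⁰(Q) ≤ P⁰(Q bH) · P¹(Q)` (`bHQ_pin_open_mul_le`)
because with `e` open `Q` forces `v ∉ H`, the events `{b ∈ H, Q, v ∉ H}` and `{Q, v ∉ H}` ignore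
`e` (both ends of `e` lie outside `H`: `Hull.cluster_update_eq_of_notMem`), and
van den Berg–Kahn / BHK06 1.3 (`vdBK`) says that the cluster of `a₂` avoiding `{a₁, v}` has
`b ∈ H` less often than the cluster avoiding `{a₁}`; quantitatively
`c1CrossOpenHalf · P⁰(Q) = P¹(Q) · c1Slack p[e↦0] + P⁰(Q oU) · (P⁰(Q bH) P¹(Q) − P¹(Q bH) P⁰(Q))`
(`crossOpenHalf_mul_eq`), both summands `≥ 0`.

The closed half at a root edge — the MERGE statement
`P_G(Q, b ∈ H) · P_{G/a₁v}(Q, o ∈ U) ≤ P_G(Q) · P_{G/a₁v}(Q, o ∈ U, b ∈ U)` — is FALSE in general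
(exact witness, P2-G33-CROSS §4: n = 6, edges 34 13 12 15 02 25 05 04, (a₁, a₂, o, b) = (3, 0, 4, 5),
e = 13, the closed half `−8.26·10⁻⁶` against the open half `+4.15·10⁻⁵`), so
`c1Slack_nonneg_of_cross_or_rootHalf` (the row from «a fractional edge with `c1Cross ≥ 0` OR a
fractional root edge with closed half `≥ 0`») records only that the OPEN half is never the
obstruction at a root edge; the single open statement of the route stays `CrossNonneg`.  Std axioms.
-/

namespace Summit.Ventures.PercRepro2

namespace RowC1

section CrossRoot

variable {V : Type*} {E : Type*} [Fintype E] [DecidableEq E] [Fintype V] [DecidableEq V]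
  {R : Type*} [Field R] [LinearOrder R] [IsStrictOrderedRing R]

/-- The **open half** of the cross term: `P¹(Q) P⁰(Q oU bU) − P¹(Q bH) P⁰(Q oU)`. -/
noncomputable def c1CrossOpenHalf (p : E → R) (ends : E → Sym2 V) (a₁ a₂ o b : V) (e : E) : R :=
  prob (Function.update p e (1 : R)) (connEvent ends a₁ a₂)ᶜ *
      prob (Function.update p e (0 : R)) ((connEvent ends a₁ o ∪ connEvent ends a₂ o) ∩
        (connEvent ends a₁ b ∪ connEvent ends a₂ b) ∩ (connEvent ends a₁ a₂)ᶜ) -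
    prob (Function.update p e (1 : R)) (connEvent ends a₂ b ∩ (connEvent ends a₁ a₂)ᶜ) *
      prob (Function.update p e (0 : R))
        ((connEvent ends a₁ o ∪ connEvent ends a₂ o) ∩ (connEvent ends a₁ a₂)ᶜ)

/-- The **closed half** of the cross term: `P⁰(Q) P¹(Q oU bU) − P⁰(Q bH) P¹(Q oU)`. -/
noncomputable def c1CrossClosedHalf (p : E → R) (ends : E → Sym2 V) (a₁ a₂ o b : V) (e : E) :
    R :=
  prob (Function.update p e (0 : R)) (connEvent ends a₁ a₂)ᶜ *
      prob (Function.update p e (1 : R)) ((connEvent ends a₁ o ∪ connEvent ends a₂ o) ∩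
        (connEvent ends a₁ b ∪ connEvent ends a₂ b) ∩ (connEvent ends a₁ a₂)ᶜ) -
    prob (Function.update p e (0 : R)) (connEvent ends a₂ b ∩ (connEvent ends a₁ a₂)ᶜ) *
      prob (Function.update p e (1 : R))
        ((connEvent ends a₁ o ∪ connEvent ends a₂ o) ∩ (connEvent ends a₁ a₂)ᶜ)

omit [Fintype V] [DecidableEq V] [LinearOrder R] [IsStrictOrderedRing R] in
/-- `c1Cross = c1CrossClosedHalf + c1CrossOpenHalf`. -/
lemma c1Cross_eq_halves (p : E → R) (ends : E → Sym2 V) (a₁ a₂ o b : V) (e : E) :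
    c1Cross p ends a₁ a₂ o b e =
      c1CrossClosedHalf p ends a₁ a₂ o b e + c1CrossOpenHalf p ends a₁ a₂ o b e := by
  unfold c1Cross c1CrossClosedHalf c1CrossOpenHalf
  ring

/-! ## The events `{b ∈ H, Q, v ∉ H}` and `{Q, v ∉ H}` ignore a root edge `e = {a₁, v}` -/

section Ignore

variable {ends : E → Sym2 V} {e : E} {a₁ a₂ v : V}

omit [Fintype E] [Fintype V] [DecidableEq V] in
/-- Changing the state of `e = {a₁, v}` does not change the cluster of `a₂` when `a₁, v ∉ H`. -/
lemma cluster_a₂_update_eq (hends : ends e = s(a₁, v)) {ω : Config E} (c : Bool)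
    (h₁ : ¬ Conn ends ω a₂ a₁) (hv : ¬ Conn ends ω a₂ v) :
    cluster ends (Function.update ω e c) a₂ = cluster ends ω a₂ :=
  Hull.cluster_update_eq_of_notMem c hends (fun h => h₁ (mem_cluster.1 h))
    (fun h => hv (mem_cluster.1 h))

omit [Fintype E] [Fintype V] [DecidableEq V] in
/-- Membership in `{Q, v ∉ H} ∩ X` for `X` a cluster-of-`a₂` event is unchanged by `e = {a₁, v}`
(one direction; the other follows by updating back). -/
lemma mem_update_of_mem (hends : ends e = s(a₁, v)) {ω : Config E} (c : Bool) (x : V)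
    (h₁ : ¬ Conn ends ω a₁ a₂) (hv : ¬ Conn ends ω a₂ v) :
    (¬ Conn ends (Function.update ω e c) a₁ a₂) ∧ (¬ Conn ends (Function.update ω e c) a₂ v) ∧
      (Conn ends (Function.update ω e c) a₂ x ↔ Conn ends ω a₂ x) := by
  have hcl := cluster_a₂_update_eq (a₂ := a₂) hends c (fun h => h₁ (conn_symm h)) hv
  have key : ∀ y, Conn ends (Function.update ω e c) a₂ y ↔ Conn ends ω a₂ y := by
    intro y
    rw [← mem_cluster, ← mem_cluster, hcl]
  refine ⟨fun h => h₁ (conn_symm ((key a₁).1 (conn_symm h))), fun h => hv ((key v).1 h), key x⟩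

omit [Fintype E] [Fintype V] [DecidableEq V] [LinearOrder R] [IsStrictOrderedRing R] in
/-- The event `{b ∈ H, Q, v ∉ H}` ignores the root edge `e = {a₁, v}`. -/
lemma indicator_A_update (hends : ends e = s(a₁, v)) (b : V) (ω : Config E) (c : Bool) :
    (connEvent ends a₂ b ∩ (connEvent ends a₁ a₂)ᶜ ∩ (connEvent ends a₂ v)ᶜ).indicator
        (1 : Config E → R) (Function.update ω e c) =
      (connEvent ends a₂ b ∩ (connEvent ends a₁ a₂)ᶜ ∩ (connEvent ends a₂ v)ᶜ).indicator 1 ω := by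
  have hiff : Function.update ω e c ∈
      connEvent ends a₂ b ∩ (connEvent ends a₁ a₂)ᶜ ∩ (connEvent ends a₂ v)ᶜ ↔
      ω ∈ connEvent ends a₂ b ∩ (connEvent ends a₁ a₂)ᶜ ∩ (connEvent ends a₂ v)ᶜ := by
    simp only [Set.mem_inter_iff, Set.mem_compl_iff, mem_connEvent]
    constructor
    · rintro ⟨⟨hb, h₁⟩, hv⟩
      have := mem_update_of_mem (a₂ := a₂) hends (ω := Function.update ω e c) (ω e) b h₁ hv
      rw [Function.update_idem, Function.update_eq_self] at this
      exact ⟨⟨this.2.2.2 hb, this.1⟩, this.2.1⟩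
    · rintro ⟨⟨hb, h₁⟩, hv⟩
      have := mem_update_of_mem (a₂ := a₂) hends c b h₁ hv
      exact ⟨⟨this.2.2.2 hb, this.1⟩, this.2.1⟩
  by_cases h : ω ∈ connEvent ends a₂ b ∩ (connEvent ends a₁ a₂)ᶜ ∩ (connEvent ends a₂ v)ᶜ
  · rw [Set.indicator_of_mem h, Set.indicator_of_mem (hiff.2 h)]
    rfl
  · rw [Set.indicator_of_notMem h, Set.indicator_of_notMem (fun h' => h (hiff.1 h'))]

omit [Fintype E] [Fintype V] [DecidableEq V] [LinearOrder R] [IsStrictOrderedRing R] in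
/-- The event `{Q, v ∉ H}` ignores the root edge `e = {a₁, v}`. -/
lemma indicator_A'_update (hends : ends e = s(a₁, v)) (ω : Config E) (c : Bool) :
    ((connEvent ends a₁ a₂)ᶜ ∩ (connEvent ends a₂ v)ᶜ).indicator
        (1 : Config E → R) (Function.update ω e c) =
      ((connEvent ends a₁ a₂)ᶜ ∩ (connEvent ends a₂ v)ᶜ).indicator 1 ω := by
  have hiff : Function.update ω e c ∈ (connEvent ends a₁ a₂)ᶜ ∩ (connEvent ends a₂ v)ᶜ ↔
      ω ∈ (connEvent ends a₁ a₂)ᶜ ∩ (connEvent ends a₂ v)ᶜ := by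
    simp only [Set.mem_inter_iff, Set.mem_compl_iff, mem_connEvent]
    constructor
    · rintro ⟨h₁, hv⟩
      have := mem_update_of_mem (a₂ := a₂) hends (ω := Function.update ω e c) (ω e) v h₁ hv
      rw [Function.update_idem, Function.update_eq_self] at this
      exact ⟨this.1, this.2.1⟩
    · rintro ⟨h₁, hv⟩
      have := mem_update_of_mem (a₂ := a₂) hends c v h₁ hv
      exact ⟨this.1, this.2.1⟩
  by_cases h : ω ∈ (connEvent ends a₁ a₂)ᶜ ∩ (connEvent ends a₂ v)ᶜ
  · rw [Set.indicator_of_mem h, Set.indicator_of_mem (hiff.2 h)]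
    rfl
  · rw [Set.indicator_of_notMem h, Set.indicator_of_notMem (fun h' => h (hiff.1 h'))]

omit [Fintype E] [DecidableEq E] [Fintype V] [DecidableEq V] in
/-- With the root edge `e = {a₁, v}` open, `Q` forces `v ∉ H`. -/
lemma Q_inter_open_subset (hends : ends e = s(a₁, v)) :
    (connEvent ends a₁ a₂)ᶜ ∩ openEdge e ⊆ (connEvent ends a₂ v)ᶜ := by
  rintro ω ⟨hQ, he⟩ hv
  have hadj : Conn ends ω v a₁ := conn_of_openAdj ⟨e, he, by rw [hends, Sym2.eq_swap]⟩
  exact hQ (conn_symm (conn_trans hv hadj))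

end Ignore

/-! ## The open half at a root edge -/

omit [Fintype V] [DecidableEq V] [LinearOrder R] [IsStrictOrderedRing R] in
/-- Under `p[e↦1]` every event may be intersected with `openEdge e`. -/
lemma prob_update_one_eq_inter_open (p : E → R) (e : E) (X : Set (Config E)) :
    prob (Function.update p e (1 : R)) X =
      prob (Function.update p e (1 : R)) (X ∩ openEdge e) :=
  (prob_update_one_inter_openEdge p X e).symm

/-- **The root-edge comparison**: for `e = {a₁, v}`,
`P¹(Q, b ∈ H) · P⁰(Q) ≤ P⁰(Q, b ∈ H) · P¹(Q)` — opening a root edge lowers `P(b ∈ H | Q)`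
(van den Berg–Kahn with the avoided sets `{a₁, v} ⊇ {a₁}`). -/
theorem bHQ_pin_open_mul_le (p : E → R) (hp : IsProbVec p) (ends : E → Sym2 V) {e : E}
    {a₁ v : V} (hends : ends e = s(a₁, v)) (a₂ b : V) :
    prob (Function.update p e (1 : R)) (connEvent ends a₂ b ∩ (connEvent ends a₁ a₂)ᶜ) *
        prob (Function.update p e (0 : R)) (connEvent ends a₁ a₂)ᶜ ≤
      prob (Function.update p e (0 : R)) (connEvent ends a₂ b ∩ (connEvent ends a₁ a₂)ᶜ) *
        prob (Function.update p e (1 : R)) (connEvent ends a₁ a₂)ᶜ := by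
  classical
  -- the half-weight vector `p̃ = p[e↦1/2]`; `p̃[e↦1] = p[e↦1]`, `p̃[e↦0] = p[e↦0]`
  set q : E → R := Function.update p e (1 / 2 : R) with hq
  have hq0 : (0 : R) ≤ 1 / 2 := by norm_num
  have hq1 : (1 / 2 : R) ≤ 1 := by norm_num
  have hqp : IsProbVec q := hp.update e hq0 hq1
  have hq_e : q e = 1 / 2 := by simp [hq]
  have hq1' : Function.update q e (1 : R) = Function.update p e (1 : R) := by
    simp [hq, Function.update_idem]
  have hq0' : Function.update q e (0 : R) = Function.update p e (0 : R) := by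
    simp [hq, Function.update_idem]
  set Q : Set (Config E) := (connEvent ends a₁ a₂)ᶜ with hQdef
  set bHQ : Set (Config E) := connEvent ends a₂ b ∩ (connEvent ends a₁ a₂)ᶜ with hbHQdef
  set A : Set (Config E) :=
    connEvent ends a₂ b ∩ (connEvent ends a₁ a₂)ᶜ ∩ (connEvent ends a₂ v)ᶜ with hAdef
  set A' : Set (Config E) := (connEvent ends a₁ a₂)ᶜ ∩ (connEvent ends a₂ v)ᶜ with hA'def
  -- (1) the `e`-open masses are the masses of the `e`-free events `A`, `A'`
  have hAopen : bHQ ∩ openEdge e = A ∩ openEdge e := by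
    ext ω
    simp only [hbHQdef, hAdef, Set.mem_inter_iff]
    constructor
    · rintro ⟨⟨hb, hQω⟩, he⟩
      exact ⟨⟨⟨hb, hQω⟩, Q_inter_open_subset (a₂ := a₂) hends ⟨hQω, he⟩⟩, he⟩
    · rintro ⟨⟨⟨hb, hQω⟩, _⟩, he⟩
      exact ⟨⟨hb, hQω⟩, he⟩
  have hA'open : Q ∩ openEdge e = A' ∩ openEdge e := by
    ext ω
    simp only [hQdef, hA'def, Set.mem_inter_iff]
    constructor
    · rintro ⟨hQω, he⟩
      exact ⟨⟨hQω, Q_inter_open_subset (a₂ := a₂) hends ⟨hQω, he⟩⟩, he⟩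
    · rintro ⟨⟨hQω, _⟩, he⟩
      exact ⟨hQω, he⟩
  have e1 : prob (Function.update p e (1 : R)) bHQ = prob q A := by
    rw [prob_update_one_eq_inter_open, hAopen, ← prob_update_one_eq_inter_open, ← hq1',
      CaseOne.prob_update_of_ignore q e 1 A (fun ω c => indicator_A_update hends b ω c)]
  have e2 : prob (Function.update p e (1 : R)) Q = prob q A' := by
    rw [prob_update_one_eq_inter_open, hA'open, ← prob_update_one_eq_inter_open, ← hq1',
      CaseOne.prob_update_of_ignore q e 1 A' (fun ω c => indicator_A'_update hends ω c)]
  -- (2) the pinning identities at `q`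
  have pin1 : prob q Q = (1 / 2 : R) * prob (Function.update p e (1 : R)) Q +
      (1 - 1 / 2) * prob (Function.update p e (0 : R)) Q := by
    rw [prob_eq_pin q Q e, hq_e, hq1', hq0']
  have pin2 : prob q bHQ = (1 / 2 : R) * prob (Function.update p e (1 : R)) bHQ +
      (1 - 1 / 2) * prob (Function.update p e (0 : R)) bHQ := by
    rw [prob_eq_pin q bHQ e, hq_e, hq1', hq0']
  -- (3) van den Berg–Kahn at `q`: `P(A) P(Q) ≤ P(bHQ) P(A')`
  have hvdbk := vdBK q hqp ends a₂ {b} ∅ {a₁, v} {a₁}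
  have s1 : connAll ends a₂ {b} ∩ avoidAll ends a₂ {a₁, v} = A := by
    ext ω
    simp only [hAdef, connAll, avoidAll, Set.mem_setOf_eq, Set.mem_inter_iff, Set.mem_compl_iff,
      mem_connEvent, Finset.mem_singleton, forall_eq, Finset.mem_insert, forall_eq_or_imp]
    constructor
    · rintro ⟨hb, h₁, hv⟩
      exact ⟨⟨hb, fun h => h₁ (conn_symm h)⟩, hv⟩
    · rintro ⟨⟨hb, h₁⟩, hv⟩
      exact ⟨hb, fun h => h₁ (conn_symm h), hv⟩
  have s2 : connAll ends a₂ ∅ ∩ avoidAll ends a₂ {a₁} = Q := by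
    ext ω
    simp only [hQdef, connAll, avoidAll, Set.mem_setOf_eq, Set.mem_inter_iff, Set.mem_compl_iff,
      mem_connEvent, Finset.notMem_empty, false_imp_iff, imp_true_iff, true_and,
      Finset.mem_singleton, forall_eq]
    exact ⟨fun h h' => h (conn_symm h'), fun h h' => h (conn_symm h')⟩
  have s3 : connAll ends a₂ ({b} ∪ ∅) ∩ avoidAll ends a₂ ({a₁, v} ∩ {a₁}) = bHQ := by
    have hI : ({a₁, v} : Finset V) ∩ {a₁} = {a₁} := by
      ext x; simp only [Finset.mem_inter, Finset.mem_insert, Finset.mem_singleton]; tauto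
    rw [hI, Finset.union_empty]
    ext ω
    simp only [hbHQdef, connAll, avoidAll, Set.mem_setOf_eq, Set.mem_inter_iff, Set.mem_compl_iff,
      mem_connEvent, Finset.mem_singleton, forall_eq]
    exact ⟨fun ⟨hb, h⟩ => ⟨hb, fun h' => h (conn_symm h')⟩,
      fun ⟨hb, h⟩ => ⟨hb, fun h' => h (conn_symm h')⟩⟩
  have s4 : avoidAll ends a₂ ({a₁, v} ∪ {a₁}) = A' := by
    have hU : ({a₁, v} : Finset V) ∪ {a₁} = {a₁, v} := by
      ext x; simp only [Finset.mem_union, Finset.mem_insert, Finset.mem_singleton]; tauto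
    rw [hU]
    ext ω
    simp only [hA'def, avoidAll, Set.mem_setOf_eq, Set.mem_inter_iff, Set.mem_compl_iff,
      mem_connEvent, Finset.mem_insert, Finset.mem_singleton, forall_eq_or_imp, forall_eq]
    exact ⟨fun ⟨h₁, hv⟩ => ⟨fun h => h₁ (conn_symm h), hv⟩,
      fun ⟨h₁, hv⟩ => ⟨fun h => h₁ (conn_symm h), hv⟩⟩
  rw [s1, s2, s3, s4] at hvdbk
  -- (4) conclude
  rw [pin1, pin2, ← e1, ← e2] at hvdbk
  nlinarith [hvdbk]

/-- **The open half of the cross term at a root edge is nonnegative** as soon as the row holds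
for `p[e↦0]`: `c1CrossOpenHalf · P⁰(Q) ≥ P¹(Q) · c1Slack p[e↦0]`. -/
theorem crossOpenHalf_nonneg_of_row (p : E → R) (hp : IsProbVec p) (ends : E → Sym2 V) {e : E}
    {a₁ v : V} (hends : ends e = s(a₁, v)) (a₂ o b : V)
    (hrow : 0 ≤ c1Slack (Function.update p e (0 : R)) ends a₁ a₂ o b) :
    0 ≤ c1CrossOpenHalf p ends a₁ a₂ o b e := by
  have hp0 : IsProbVec (Function.update p e (0 : R)) := hp.update e le_rfl zero_le_one
  have hp1 : IsProbVec (Function.update p e (1 : R)) := hp.update e zero_le_one le_rfl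
  have hcmp := bHQ_pin_open_mul_le p hp ends hends a₂ b
  unfold c1Slack at hrow
  unfold c1CrossOpenHalf
  set Q : Set (Config E) := (connEvent ends a₁ a₂)ᶜ with hQdef
  set bHQ : Set (Config E) := connEvent ends a₂ b ∩ (connEvent ends a₁ a₂)ᶜ with hbHQdef
  set oUQ : Set (Config E) :=
    (connEvent ends a₁ o ∪ connEvent ends a₂ o) ∩ (connEvent ends a₁ a₂)ᶜ with hoUQdef
  set oUbUQ : Set (Config E) := (connEvent ends a₁ o ∪ connEvent ends a₂ o) ∩
    (connEvent ends a₁ b ∪ connEvent ends a₂ b) ∩ (connEvent ends a₁ a₂)ᶜ with hoUbUQdef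
  set P0 := Function.update p e (0 : R) with hP0
  set P1 := Function.update p e (1 : R) with hP1
  have n0Q : 0 ≤ prob P0 Q := prob_nonneg hp0 _
  have n1Q : 0 ≤ prob P1 Q := prob_nonneg hp1 _
  have n0oU : 0 ≤ prob P0 oUQ := prob_nonneg hp0 _
  have n0oUbU : 0 ≤ prob P0 oUbUQ := prob_nonneg hp0 _
  have n1bH : 0 ≤ prob P1 bHQ := prob_nonneg hp1 _
  have n0bH : 0 ≤ prob P0 bHQ := prob_nonneg hp0 _
  rcases n0Q.lt_or_eq with hpos | hzero
  · -- `P⁰(Q) > 0`: multiply through by `P⁰(Q)`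
    have key : 0 * prob P0 Q ≤ (prob P1 Q * prob P0 oUbUQ - prob P1 bHQ * prob P0 oUQ) * prob P0 Q := by
      nlinarith [mul_le_mul_of_nonneg_right hcmp n0oU, mul_nonneg n1Q hrow]
    exact le_of_mul_le_mul_right key hpos
  · -- `P⁰(Q) = 0`: both `P⁰` masses vanish (they sit inside `Q`)
    have h1 : prob P0 oUbUQ = 0 :=
      le_antisymm (by rw [hzero]; exact prob_mono hp0 Set.inter_subset_right) n0oUbU
    have h2 : prob P0 oUQ = 0 :=
      le_antisymm (by rw [hzero]; exact prob_mono hp0 Set.inter_subset_right) n0oU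
    rw [h1, h2]
    simp

omit [Fintype V] [DecidableEq V] [LinearOrder R] [IsStrictOrderedRing R] in
/-- **The open half at a root edge, quantitatively**:
`c1CrossOpenHalf · P⁰(Q) = P¹(Q) · c1Slack p[e↦0] + P⁰(Q oU) · (P⁰(Q bH) P¹(Q) − P¹(Q bH) P⁰(Q))`
(a ring identity; the last factor is `≥ 0` by `bHQ_pin_open_mul_le`). -/
theorem crossOpenHalf_mul_eq (p : E → R) (ends : E → Sym2 V) (a₁ a₂ o b : V) (e : E) :
    c1CrossOpenHalf p ends a₁ a₂ o b e * prob (Function.update p e (0 : R)) (connEvent ends a₁ a₂)ᶜ =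
      prob (Function.update p e (1 : R)) (connEvent ends a₁ a₂)ᶜ *
          c1Slack (Function.update p e (0 : R)) ends a₁ a₂ o b +
        prob (Function.update p e (0 : R))
            ((connEvent ends a₁ o ∪ connEvent ends a₂ o) ∩ (connEvent ends a₁ a₂)ᶜ) *
          (prob (Function.update p e (0 : R)) (connEvent ends a₂ b ∩ (connEvent ends a₁ a₂)ᶜ) *
              prob (Function.update p e (1 : R)) (connEvent ends a₁ a₂)ᶜ -
            prob (Function.update p e (1 : R)) (connEvent ends a₂ b ∩ (connEvent ends a₁ a₂)ᶜ) *
              prob (Function.update p e (0 : R)) (connEvent ends a₁ a₂)ᶜ) := by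
  unfold c1CrossOpenHalf c1Slack
  ring

/-- **Row 2′C1 from the cross term OR the root-edge closed half**: if every admissible weight vector
with a fractional edge has a fractional edge `e` with `0 ≤ c1Cross p e`, or a fractional ROOT edge
`e = {a₁, v}` with `0 ≤ c1CrossClosedHalf p e`, then row 2′C1 holds for every admissible weight
vector.  (The second branch is the MERGE statement, FALSE in general — see the header; the theorem
records that at a root edge the open half never obstructs.) -/
theorem c1Slack_nonneg_of_cross_or_rootHalf (ends : E → Sym2 V) (a₁ a₂ o b : V)
    (hC : ∀ p : E → R, IsProbVec p → (∃ e, p e ≠ 0 ∧ p e ≠ 1) →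
      ∃ e, p e ≠ 0 ∧ p e ≠ 1 ∧ (0 ≤ c1Cross p ends a₁ a₂ o b e ∨
        ((∃ v, ends e = s(a₁, v)) ∧ 0 ≤ c1CrossClosedHalf p ends a₁ a₂ o b e))) :
    ∀ p : E → R, IsProbVec p → 0 ≤ c1Slack p ends a₁ a₂ o b := by
  intro p hp
  generalize hn : (CDQC.fracEdges p).card = n
  induction n using Nat.strong_induction_on generalizing p with
  | _ n ih =>
    by_cases h0 : CDQC.fracEdges p = ∅
    · have hq : ∀ f, p f = 0 ∨ p f = 1 := by
        intro f
        by_contra hcon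
        have : f ∈ CDQC.fracEdges p := (mem_fracEdges_iff p f).2 (not_or.1 hcon)
        rw [h0] at this
        exact absurd this (Finset.notMem_empty f)
      exact c1Slack_nonneg_of_pinned p hp hq ends a₁ a₂ o b
    · obtain ⟨g, hg⟩ := Finset.nonempty_iff_ne_empty.mpr h0
      obtain ⟨e, he0, he1, hcase⟩ := hC p hp ⟨g, (mem_fracEdges_iff p g).1 hg⟩
      have he : e ∈ CDQC.fracEdges p := (mem_fracEdges_iff p e).2 ⟨he0, he1⟩
      have hpos : 0 < n := by
        rw [← hn]
        exact Finset.card_pos.mpr ⟨e, he⟩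
      have hc1 : (CDQC.fracEdges (Function.update p e (1 : R))).card = n - 1 := by
        rw [CDQC.card_fracEdges_update p he (Or.inr rfl), hn]
      have hc0 : (CDQC.fracEdges (Function.update p e (0 : R))).card = n - 1 := by
        rw [CDQC.card_fracEdges_update p he (Or.inl rfl), hn]
      have h1 : 0 ≤ c1Slack (Function.update p e (1 : R)) ends a₁ a₂ o b :=
        ih (n - 1) (Nat.sub_lt hpos Nat.one_pos) (Function.update p e 1)
          (hp.update e zero_le_one le_rfl) hc1
      have h0' : 0 ≤ c1Slack (Function.update p e (0 : R)) ends a₁ a₂ o b :=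
        ih (n - 1) (Nat.sub_lt hpos Nat.one_pos) (Function.update p e 0)
          (hp.update e le_rfl zero_le_one) hc0
      have hcross : 0 ≤ c1Cross p ends a₁ a₂ o b e := by
        rcases hcase with h | ⟨⟨v, hv⟩, hhalf⟩
        · exact h
        · rw [c1Cross_eq_halves]
          exact add_nonneg hhalf (crossOpenHalf_nonneg_of_row p hp ends hv a₂ o b h0')
      rw [c1Slack_eq_pin p ends a₁ a₂ o b e]
      have hpe0 : 0 ≤ p e := hp.nonneg e
      have hpe1 : 0 ≤ 1 - p e := sub_nonneg.2 (hp.le_one e)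
      have t1 : 0 ≤ (1 - p e) ^ 2 * c1Slack (Function.update p e (0 : R)) ends a₁ a₂ o b :=
        mul_nonneg (sq_nonneg _) h0'
      have t2 : 0 ≤ (p e) ^ 2 * c1Slack (Function.update p e (1 : R)) ends a₁ a₂ o b :=
        mul_nonneg (sq_nonneg _) h1
      have t3 : 0 ≤ p e * (1 - p e) * c1Cross p ends a₁ a₂ o b e :=
        mul_nonneg (mul_nonneg hpe0 hpe1) hcross
      linarith

end CrossRoot

end RowC1

end Summit.Ventures.PercRepro2
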